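import Summits.ValiantsHypothesis.ValiantsHypothesis.Theses.FermionizationDimension
import Summits.ValiantsHypothesis.ValiantsHypothesis.Theorems.TwistedDetRankTdrSuperadditive

/-!
# Route FermionizationDimension — crux `SDimPerNotQP` (stmt-ValiantsHypothesis-7286):
# the reduced (semisimple) case of junk rigidity

Stub `stub_junkRigidityReduced` (J_red) of the line `registered` of
`Cruxes/SDimPerNotQP/Lines/birth.lean`: a commutative realisation `(R, u, ℓ)` of the sign character
of `𝔖ₙ` — `ℓ (∏ i, u (σ i) i) = sgn σ` for all `σ` — over a REDUCED finite-dimensional commutative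
`ℂ`-algebra `R` is a sum of at most `finrank ℂ R` Hadamard-twisted determinants:
`per_n = Σ_{t<r} det (X ∘ E_t)` with `r ≤ finrank ℂ R`.

Proof (Artin–Wedderburn bookkeeping). `R` is Artinian (`IsArtinianRing.of_finite ℂ R`) and reduced,
so `IsArtinianRing.equivPi : R ≃ₐ[R] Π_{I ∈ MaxSpec R} R ⧸ I`; each residue field is a finite
extension of the algebraically closed field `ℂ`, hence `ℂ` itself
(`IsAlgClosed.algebraMap_bijective_of_isIntegral`). This gives a `ℂ`-algebra isomorphism
`Φ : R ≃ₐ[ℂ] (Fin r → ℂ)` with `r = finrank ℂ R` (`exists_algEquiv_fun`), i.e. `r` characters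
`x ↦ Φ x t`. Expanding along the standard basis, `ℓ x = Σ_t ℓ(Φ⁻¹ e_t) · Φ x t`
(`linearMap_apply_eq_sum`), so `sgn σ = Σ_t a_t ∏ i, Φ (u (σ i) i) t` is a scalar combination of
`r` transversal product patterns. For `n ≥ 1` the scalars are absorbed into a column
(`TwistedDetRankTdrSuperadditive.exists_rep_of_smul_rep`) and the pattern identity is the
coefficient form of `per_n = Σ_t det (X ∘ E_t)`
(`TwistedDetRankTdrSuperadditive.perPoly_eq_sum_twistedDet_iff`); for `n = 0` one twisted
determinant suffices and `r ≥ 1` because `sgn ≠ 0`.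

Sources: folklore (Artin–Wedderburn for commutative reduced finite-dimensional `ℂ`-algebras);
M. Marcus, H. Minc, Illinois J. Math. 5 (1961) (the model).
-/

-- `Summit.<Summit>.<Problem>` repeats `ValiantsHypothesis` by the tree's layout convention (D-0017).
set_option linter.dupNamespace false

namespace Summit.ValiantsHypothesis.ValiantsHypothesis.Theorems

namespace FermionizationDimensionSDimPerNotQPJunkRigidityReduced

/-- **Structure of reduced finite-dimensional commutative `ℂ`-algebras.** A reduced commutative
`ℂ`-algebra of finite dimension is `ℂ`-algebra isomorphic to `Fin r → ℂ` for some `r`: it is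
Artinian, hence the product of its residue fields at the finitely many maximal ideals
(`IsArtinianRing.equivPi`), and each residue field, being finite over the algebraically closed
field `ℂ`, is `ℂ`. [folklore; Artin–Wedderburn] -/
theorem exists_algEquiv_fun (R : Type) [CommRing R] [Algebra ℂ R] [Module.Finite ℂ R]
    [IsReduced R] : ∃ r : ℕ, Nonempty (R ≃ₐ[ℂ] (Fin r → ℂ)) := by
  haveI : IsArtinianRing R := IsArtinianRing.of_finite ℂ R
  letI : Fintype (MaximalSpectrum R) := Fintype.ofFinite _
  -- the residue fields are `ℂ`
  have e₂ : ∀ I : MaximalSpectrum R, (R ⧸ I.asIdeal) ≃ₐ[ℂ] ℂ := fun I =>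
    (AlgEquiv.ofBijective (Algebra.ofId ℂ (R ⧸ I.asIdeal))
      IsAlgClosed.algebraMap_bijective_of_isIntegral).symm
  -- reduced Artinian: `R` is the product of its residue fields
  have e₁ : R ≃ₐ[ℂ] (∀ I : MaximalSpectrum R, R ⧸ I.asIdeal) :=
    (IsArtinianRing.equivPi R).restrictScalars ℂ
  exact ⟨Fintype.card (MaximalSpectrum R),
    ⟨(e₁.trans (AlgEquiv.piCongrRight e₂)).trans
      (AlgEquiv.piCongrLeft' ℂ (fun _ : MaximalSpectrum R => ℂ) (Fintype.equivFin _))⟩⟩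

/-- **Dual expansion along the characters.** If `Φ : R ≃ₐ[ℂ] (Fin r → ℂ)` then every linear
functional `ℓ` on `R` is the combination `ℓ x = Σ_t ℓ (Φ⁻¹ e_t) · Φ x t` of the `r` characters
`x ↦ Φ x t` (expand `Φ x` along the standard basis `e_t = Pi.single t 1`). [folklore] -/
theorem linearMap_apply_eq_sum {R : Type} [CommRing R] [Algebra ℂ R] {r : ℕ}
    (Φ : R ≃ₐ[ℂ] (Fin r → ℂ)) (ℓ : R →ₗ[ℂ] ℂ) (x : R) :
    ℓ x = ∑ t, ℓ (Φ.symm (Pi.single t 1)) * Φ x t := by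
  conv_lhs => rw [← Φ.symm_apply_apply x, pi_eq_sum_univ' (Φ x), map_sum, map_sum]
  refine Finset.sum_congr rfl fun t _ => ?_
  rw [map_smul, map_smul, smul_eq_mul, mul_comm]

/-- **Pattern form of a reduced realisation.** A commutative realisation `ℓ (∏ i, u (σ i) i) = sgn σ`
over a reduced finite-dimensional commutative `ℂ`-algebra `R` exhibits `sgn` as a scalar
combination of `r = finrank ℂ R` transversal product patterns:
`sgn σ = Σ_{t<r} a_t ∏ i, E_t (σ i) i`. [folklore; Artin–Wedderburn, MarcusMinc1961] -/
theorem exists_smul_rep_of_realisation {n : ℕ} (R : Type) [CommRing R] [Algebra ℂ R]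
    [Module.Finite ℂ R] [IsReduced R] (u : Fin n → Fin n → R) (ℓ : R →ₗ[ℂ] ℂ)
    (hu : ∀ σ : Equiv.Perm (Fin n), ℓ (∏ i, u (σ i) i) = ((Equiv.Perm.sign σ : ℤ) : ℂ)) :
    ∃ r : ℕ, Module.finrank ℂ R = r ∧ ∃ (a : Fin r → ℂ) (E : Fin r → Matrix (Fin n) (Fin n) ℂ),
      ∀ σ : Equiv.Perm (Fin n), ((Equiv.Perm.sign σ : ℤ) : ℂ) = ∑ t, a t * ∏ i, E t (σ i) i := by
  obtain ⟨r, ⟨Φ⟩⟩ := exists_algEquiv_fun R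
  refine ⟨r, by rw [Φ.toLinearEquiv.finrank_eq, Module.finrank_fin_fun],
    fun t => ℓ (Φ.symm (Pi.single t 1)), fun t i j => Φ (u i j) t, fun σ => ?_⟩
  rw [← hu σ, linearMap_apply_eq_sum Φ ℓ, map_prod]
  refine Finset.sum_congr rfl fun t _ => ?_
  rw [Finset.prod_apply]

end FermionizationDimensionSDimPerNotQPJunkRigidityReduced

open FermionizationDimensionSDimPerNotQPJunkRigidityReduced TwistedDetRankTdrSuperadditive in
/-- **J_red — junk rigidity, reduced case** (stub `stub_junkRigidityReduced` of the line
`registered` of crux `SDimPerNotQP`, stmt-ValiantsHypothesis-7286): a realisation of `sgn_n` over a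
REDUCED commutative finite-dimensional `ℂ`-algebra `R` is a sum of at most `finrank ℂ R`
Hadamard-twisted determinants, `per_n = Σ_{t<r} det (X ∘ E_t)` with `r ≤ finrank ℂ R`.
Semisimple bookkeeping: `R ≅ ℂ^r` through its characters (`exists_algEquiv_fun`), `ℓ` is a
combination of the characters, so `sgn` is a combination of `r` transversal product patterns
(`exists_smul_rep_of_realisation`); absorb the scalars into a column (`n ≥ 1`) and compare
coefficients of permutation monomials; `n = 0`: one empty determinant, and `r ≥ 1` as `sgn ≠ 0`.
[folklore; Artin–Wedderburn, MarcusMinc1961] -/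
theorem stub_junkRigidityReduced :
    ∀ (n : ℕ) (R : Type) [CommRing R] [Algebra ℂ R] [Module.Finite ℂ R] [IsReduced R]
      (u : Fin n → Fin n → R) (ℓ : R →ₗ[ℂ] ℂ),
      (∀ σ : Equiv.Perm (Fin n), ℓ (∏ i, u (σ i) i) = ((Equiv.Perm.sign σ : ℤ) : ℂ)) →
      ∃ r ≤ Module.finrank ℂ R, ∃ E : Fin r → Matrix (Fin n) (Fin n) ℂ,
        Literature.Computability.AlgebraicComplexity.perPoly (Fin n) ℂ =
          ∑ t, (Matrix.of fun i j => MvPolynomial.C (E t i j) * MvPolynomial.X (i, j)).det := by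
  intro n R _ _ _ _ u ℓ hu
  obtain ⟨r, hr, a, E, hE⟩ := exists_smul_rep_of_realisation R u ℓ hu
  rcases Nat.eq_zero_or_pos n with rfl | hn
  · -- `n = 0`: the empty permanent is one empty determinant; `r ≥ 1` since `sgn 1 = 1 ≠ 0`
    refine ⟨1, ?_, fun _ => 0, perPoly_fin_zero_eq_sum_one _⟩
    rw [hr]
    rcases Nat.eq_zero_or_pos r with rfl | hr1
    · have h1 := hE 1
      simp at h1
    · exact hr1
  · -- `n ≥ 1`: absorb the scalars into column `0`, then compare coefficients
    obtain ⟨F, hF⟩ := exists_rep_of_smul_rep hn _ a E hE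
    exact ⟨r, hr.ge, F, (perPoly_eq_sum_twistedDet_iff F).2 hF⟩

end Summit.ValiantsHypothesis.ValiantsHypothesis.Theorems
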